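import Summits.Ventures.PercRepro.Night2LocalD2R14SixZeroA

/-!
# PercRepro — the six-element columns of R1₄ without a far preimage, part B: two covering preimages (night-2, gen 16)

At a six-element shadow set `S` of the coloop cell with two covering preimages `S ∖ {z₁}`, `S ∖ {z₂}` of `|G ∖ cl B| ≥ 2`
(the cell `κ = 2` of proofs/NIGHT-2-k1.md §7.1): the pair sets are the 2-subsets of `C = S ∖ {y, z₁, z₂}`
(`card_pairPre_le_three_of_two_covPre_six`), and three pair preimages cannot all have `|G ∖ cl B| = 3`
(`not_three_pairs_of_three`: their closures pairwise meet inside `cl {y, z₁, z₂}`, so `G ∖ S` lies in `cl {y, z₁, z₂}` up to one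
point and `S ∖ {z₁}` could not be a member).  With at most two covering preimages (`card_r14CovPre_le_two_six`) and at most
three basis points (Night2LocalD2R14SixZeroA):

**`sum_r14W_col_le_of_card_six_of_two_covPre`**: the column is `≤ 2/5 + 12/35 + 14/75 + 9/140 < 1`.
-/

namespace PercRepro.Shadow

open Finset PerFlat ThmH

variable {α : Type*} [DecidableEq α] {M : Matroid α} [M.Finite]

open scoped Classical in
/-- Two distinct covering preimages with `|G ∖ cl B| ≥ 2` are the faces `S ∖ {z₁}`, `S ∖ {z₂}` at two distinct coloops
`z₁, z₂ ≠ y` of `S`. -/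
theorem two_coloops_of_two_covPre {G : Finset α} (hG : G ∈ flatsQ M (4 + 1)) {y : α} (hyG : y ∈ G)
    (hyc : y ∉ clF M (G.erase y)) {S B₁ B₂ : Finset α} (h₁ : B₁ ∈ r14CovPre M G S) (h₂ : B₂ ∈ r14CovPre M G S)
    (hne : B₁ ≠ B₂) :
    ∃ z₁ z₂, z₁ ∈ S ∧ z₂ ∈ S ∧ z₁ ≠ y ∧ z₂ ≠ y ∧ z₁ ≠ z₂ ∧ B₁ = S.erase z₁ ∧ B₂ = S.erase z₂ ∧
      z₁ ∉ clF M (S.erase z₁) ∧ z₂ ∉ clF M (S.erase z₂) ∧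
      S.erase z₁ ∈ membersIn M (Uq M (4 + 2) 4) G ∧ S.erase z₂ ∈ membersIn M (Uq M (4 + 2) 4) G := by
  obtain ⟨z₁, hz₁S, hz₁y, hB₁, hz₁, -⟩ := exists_coloop_of_mem_r14CovPre hG hyG hyc h₁
  obtain ⟨z₂, hz₂S, hz₂y, hB₂, hz₂, -⟩ := exists_coloop_of_mem_r14CovPre hG hyG hyc h₂
  have hm₁ : B₁ ∈ membersIn M (Uq M (4 + 2) 4) G := by
    unfold r14CovPre at h₁
    exact (mem_coverPreimages.1 (Finset.mem_filter.1 h₁).1).1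
  have hm₂ : B₂ ∈ membersIn M (Uq M (4 + 2) 4) G := by
    unfold r14CovPre at h₂
    exact (mem_coverPreimages.1 (Finset.mem_filter.1 h₂).1).1
  refine ⟨z₁, z₂, hz₁S, hz₂S, hz₁y, hz₂y, fun h => hne (by rw [hB₁, hB₂, h]), hB₁, hB₂, hz₁, hz₂, ?_, ?_⟩
  · rw [← hB₁]; exact hm₁
  · rw [← hB₂]; exact hm₂

open scoped Classical in
/-- With two covering preimages of `|G ∖ cl B| ≥ 2` at `|S| = 6`, every pair set is a 2-subset of the 3-set
`S ∖ {y, z₁, z₂}`; hence there are at most three pair preimages. -/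
theorem card_pairPre_le_three_of_two_covPre_six {G : Finset α} (hG : G ∈ flatsQ M (4 + 1)) {y : α} (hyG : y ∈ G)
    (hyc : y ∉ clF M (G.erase y)) {S : Finset α} (hS : S ∈ shadowAt M (4 + 2) 4 (Uq M (4 + 2) 4) G)
    (h6 : S.card = 6) {z₁ z₂ : α} (hz₁S : z₁ ∈ S) (hz₂S : z₂ ∈ S) (hz₁y : z₁ ≠ y) (hz₂y : z₂ ≠ y) (hz₁₂ : z₁ ≠ z₂)
    (hm₁ : S.erase z₁ ∈ membersIn M (Uq M (4 + 2) 4) G) (hm₂ : S.erase z₂ ∈ membersIn M (Uq M (4 + 2) 4) G) :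
    (∀ B ∈ pairPre M 4 G S, S \ B ⊆ S \ {y, z₁, z₂}) ∧ (pairPre M 4 G S).card ≤ 3 := by
  have hyS : y ∈ S := mem_of_mem_shadowAt_of_coloop (by rw [rkN_erase_eq_of_coloop hG hyG hyc]) hS
  have hsub : ∀ B ∈ pairPre M 4 G S, S \ B ⊆ S \ {y, z₁, z₂} := by
    intro B hB e he
    have h₁ := notMem_sdiff_of_mem_pairPre_of_coloop hG hm₁ hB
    have h₂ := notMem_sdiff_of_mem_pairPre_of_coloop hG hm₂ hB
    rw [Finset.mem_sdiff, Finset.mem_insert, Finset.mem_insert, Finset.mem_singleton, not_or, not_or]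
    refine ⟨(Finset.mem_sdiff.1 he).1, fun h => (Finset.mem_sdiff.1 he).2 (h ▸ mem_of_mem_pairPre hG hyG hyc hB),
      fun h => h₁ (h ▸ he), fun h => h₂ (h ▸ he)⟩
  refine ⟨hsub, ?_⟩
  have hmaps : ∀ B ∈ pairPre M 4 G S, S \ B ∈ Finset.powersetCard 2 (S \ {y, z₁, z₂}) := by
    intro B hB
    rw [Finset.mem_powersetCard]
    exact ⟨hsub B hB, card_sdiff_of_mem_pairPre hB⟩
  have hinj : Set.InjOn (fun B => S \ B) (pairPre M 4 G S : Set (Finset α)) := by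
    intro B hB B' hB' h
    by_contra hne
    exact sdiff_ne_of_mem_pairPre (Finset.mem_coe.1 hB) (Finset.mem_coe.1 hB') hne h
  have h1 := Finset.card_le_card_of_injOn (fun B => S \ B) hmaps hinj
  have hc : (S \ {y, z₁, z₂}).card = 3 := by
    have h3 : ({y, z₁, z₂} : Finset α).card = 3 := by
      rw [Finset.card_insert_of_notMem, Finset.card_pair hz₁₂]
      rw [Finset.mem_insert, Finset.mem_singleton, not_or]
      exact ⟨hz₁y.symm, hz₂y.symm⟩
    have hsub3 : ({y, z₁, z₂} : Finset α) ⊆ S := by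
      intro e he
      rw [Finset.mem_insert, Finset.mem_insert, Finset.mem_singleton] at he
      rcases he with rfl | rfl | rfl
      · exact hyS
      · exact hz₁S
      · exact hz₂S
    have := Finset.card_sdiff_add_card_eq_card hsub3
    omega
  rw [Finset.card_powersetCard, hc] at h1
  have h33 : Nat.choose 3 2 = 3 := by decide
  omega

open scoped Classical in
/-- **Three pair preimages all of `|G ∖ cl B| = 3` are impossible with a covering preimage `S ∖ {z₁}` whose pair sets
avoid `y, z₁, z₂`**: their closures pairwise meet inside `Λ = cl {y, z₁, z₂}`, so `G ∖ S ⊆ Λ ∪ {one point}` and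
`S ∖ {z₁}` could not be a member (`ρ(E ∖ (S ∖ z₁)) ≤ 5`). -/
theorem not_three_pairs_of_three {G : Finset α} (hG : G ∈ flatsQ M (4 + 1)) (hd : (gr M \ G).card = 2)
    (hsimple : ∀ e ∈ gr M, ∀ f ∈ gr M, e ≠ f → rkN M {e, f} = 2) {y : α} (hyG : y ∈ G)
    (hyc : y ∉ clF M (G.erase y)) {S : Finset α} (hS : S ∈ shadowAt M (4 + 2) 4 (Uq M (4 + 2) 4) G)
    {z₁ z₂ : α} (hz₁S : z₁ ∈ S) (hz₂S : z₂ ∈ S) (hz₁y : z₁ ≠ y) (hz₂y : z₂ ≠ y) (hz₁₂ : z₁ ≠ z₂)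
    (hm₁ : S.erase z₁ ∈ membersIn M (Uq M (4 + 2) 4) G) (hm₂ : S.erase z₂ ∈ membersIn M (Uq M (4 + 2) 4) G)
    {B₁ B₂ B₃ : Finset α} (hB₁ : B₁ ∈ pairPre M 4 G S) (hB₂ : B₂ ∈ pairPre M 4 G S) (hB₃ : B₃ ∈ pairPre M 4 G S)
    (h₁₂ : B₁ ≠ B₂) (h₁₃ : B₁ ≠ B₃) (h₂₃ : B₂ ≠ B₃) (hc₁ : (G \ clF M B₁).card = 3) (hc₂ : (G \ clF M B₂).card = 3)
    (hc₃ : (G \ clF M B₃).card = 3) : False := by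
  have hGg : G ⊆ gr M := (mem_flatsQ.1 hG).1
  have hSG : S ⊆ G := subset_of_mem_shadowAt hS
  have hyS : y ∈ S := mem_of_mem_shadowAt_of_coloop (by rw [rkN_erase_eq_of_coloop hG hyG hyc]) hS
  set Λ₀ : Finset α := {y, z₁, z₂} with hΛ₀def
  have hΛ₀S : Λ₀ ⊆ S := by
    intro e he
    rw [hΛ₀def, Finset.mem_insert, Finset.mem_insert, Finset.mem_singleton] at he
    rcases he with rfl | rfl | rfl
    · exact hyS
    · exact hz₁S
    · exact hz₂S
  -- `Λ₀ ⊆ Bᵢ` for every pair preimage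
  have hΛ₀B : ∀ B ∈ pairPre M 4 G S, Λ₀ ⊆ B := by
    intro B hB e he
    rw [hΛ₀def, Finset.mem_insert, Finset.mem_insert, Finset.mem_singleton] at he
    rcases he with rfl | rfl | rfl
    · exact mem_of_mem_pairPre hG hyG hyc hB
    · by_contra h
      exact notMem_sdiff_of_mem_pairPre_of_coloop hG hm₁ hB (Finset.mem_sdiff.2 ⟨hz₁S, h⟩)
    · by_contra h
      exact notMem_sdiff_of_mem_pairPre_of_coloop hG hm₂ hB (Finset.mem_sdiff.2 ⟨hz₂S, h⟩)
  have hΛ₀r : 3 ≤ rkN M Λ₀ := by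
    have hRe : ({z₁, z₂} : Finset α) ⊆ G.erase y := by
      intro e he
      rw [Finset.mem_insert, Finset.mem_singleton] at he
      rcases he with rfl | rfl
      · exact Finset.mem_erase.2 ⟨hz₁y, hSG hz₁S⟩
      · exact Finset.mem_erase.2 ⟨hz₂y, hSG hz₂S⟩
    have := three_le_rkN_insert_of_two_le_card hGg hyG hyc hsimple hRe (by rw [Finset.card_pair hz₁₂])
    exact this
  set Λ := clF M Λ₀ with hΛdef
  have hΛG : Λ ⊆ G := (clF_mono (hΛ₀B B₁ hB₁)).trans (mem_membersIn.1 (mem_pairPre.1 hB₁).1).2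
  have hI : ∀ B B' : Finset α, B ∈ pairPre M 4 G S → B' ∈ pairPre M 4 G S → B ≠ B' → clF M B ∩ clF M B' ⊆ Λ :=
    fun B B' hB hB' hne => clF_inter_subset_clF_of_three_le hG hB hB' hne (hΛ₀B B hB) (hΛ₀B B' hB') hΛ₀r
  -- `|(G ∖ S) ∖ cl Bᵢ| = 1`
  have hone : ∀ B ∈ pairPre M 4 G S, (G \ clF M B).card = 3 → ((G \ S) \ clF M B).card = 1 := by
    intro B hB hc
    have hU : B ∈ Uq M (4 + 2) 4 := (mem_membersIn.1 (mem_pairPre.1 hB).1).1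
    have hdecomp : G \ clF M B = ((G \ S) \ clF M B) ∪ (S \ B) := by
      ext e
      rw [Finset.mem_union, Finset.mem_sdiff, Finset.mem_sdiff, Finset.mem_sdiff, Finset.mem_sdiff]
      constructor
      · rintro ⟨heG, hecl⟩
        by_cases heS : e ∈ S
        · exact Or.inr ⟨heS, fun h => hecl (subset_clF hU h)⟩
        · exact Or.inl ⟨⟨heG, heS⟩, hecl⟩
      · rintro (⟨⟨heG, -⟩, hecl⟩ | he)
        · exact ⟨heG, hecl⟩
        · exact ⟨hSG he.1, (Finset.mem_sdiff.1 (sdiff_subset_of_mem_pairPre hB (Finset.mem_sdiff.2 he))).2⟩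
    have hdisj : Disjoint ((G \ S) \ clF M B) (S \ B) := by
      rw [Finset.disjoint_left]
      intro e he he'
      exact (Finset.mem_sdiff.1 (Finset.mem_sdiff.1 he).1).2 (Finset.mem_sdiff.1 he').1
    rw [hdecomp, Finset.card_union_of_disjoint hdisj, card_sdiff_of_mem_pairPre hB] at hc
    omega
  -- `W = (G ∖ S) ∖ Λ` has at most one point
  set W := (G \ S) \ Λ with hWdef
  have hW : W.card ≤ 1 := by
    have hpart : ∀ B ∈ pairPre M 4 G S, (G \ clF M B).card = 3 → W.card ≤ (W ∩ clF M B).card + 1 := by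
      intro B hB hc
      have h1 := Finset.card_sdiff_add_card_inter W (clF M B)
      have h2 : W \ clF M B ⊆ (G \ S) \ clF M B := Finset.sdiff_subset_sdiff Finset.sdiff_subset (le_refl _)
      have h3 := Finset.card_le_card h2
      rw [hone B hB hc] at h3
      omega
    have hd₁₂ : Disjoint (W ∩ clF M B₁) (W ∩ clF M B₂) := by
      rw [Finset.disjoint_left]
      intro e he he'
      exact (Finset.mem_sdiff.1 (Finset.mem_inter.1 he).1).2
        (hI B₁ B₂ hB₁ hB₂ h₁₂ (Finset.mem_inter.2 ⟨(Finset.mem_inter.1 he).2, (Finset.mem_inter.1 he').2⟩))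
    have hd₁₃ : Disjoint (W ∩ clF M B₁) (W ∩ clF M B₃) := by
      rw [Finset.disjoint_left]
      intro e he he'
      exact (Finset.mem_sdiff.1 (Finset.mem_inter.1 he).1).2
        (hI B₁ B₃ hB₁ hB₃ h₁₃ (Finset.mem_inter.2 ⟨(Finset.mem_inter.1 he).2, (Finset.mem_inter.1 he').2⟩))
    have hd₂₃ : Disjoint (W ∩ clF M B₂) (W ∩ clF M B₃) := by
      rw [Finset.disjoint_left]
      intro e he he'
      exact (Finset.mem_sdiff.1 (Finset.mem_inter.1 he).1).2
        (hI B₂ B₃ hB₂ hB₃ h₂₃ (Finset.mem_inter.2 ⟨(Finset.mem_inter.1 he).2, (Finset.mem_inter.1 he').2⟩))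
    have hu : ((W ∩ clF M B₁) ∪ (W ∩ clF M B₂) ∪ (W ∩ clF M B₃)).card ≤ W.card :=
      Finset.card_le_card (Finset.union_subset (Finset.union_subset Finset.inter_subset_left
        Finset.inter_subset_left) Finset.inter_subset_left)
    rw [Finset.card_union_of_disjoint (Finset.disjoint_union_left.2 ⟨hd₁₃, hd₂₃⟩),
      Finset.card_union_of_disjoint hd₁₂] at hu
    have := hpart B₁ hB₁ hc₁
    have := hpart B₂ hB₂ hc₂
    have := hpart B₃ hB₃ hc₃
    omega
  -- `S ∖ {z₁}` is not a member: `G ∖ (S ∖ z₁) ⊆ (Λ ∖ y) ∪ W` has rank `≤ 3`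
  have hΛr : rkN M (Λ.erase y) ≤ 2 := by
    have hyΛ : y ∈ Λ := subset_clF_of_subset_gr (hΛ₀S.trans (hSG.trans hGg)) (by
      rw [hΛ₀def]; exact Finset.mem_insert_self _ _)
    have h := rkN_insert_coloop_eq hGg hyG hyc (Finset.erase_subset_erase _ hΛG : Λ.erase y ⊆ G.erase y)
    rw [Finset.insert_erase hyΛ] at h
    have h1 : rkN M Λ ≤ rkN M Λ₀ := rkN_le_of_subset_clF' (M := M) (le_refl _)
    have h2 := rkN_le_card_fin (M := M) Λ₀
    have h3 : Λ₀.card ≤ 3 := Finset.card_le_three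
    omega
  have hsub : G \ S.erase z₁ ⊆ (Λ.erase y) ∪ W := by
    intro e he
    rw [Finset.mem_sdiff, Finset.mem_erase, not_and] at he
    rw [Finset.mem_union, Finset.mem_erase, hWdef, Finset.mem_sdiff, Finset.mem_sdiff]
    by_cases heS : e ∈ S
    · have hez : e = z₁ := by
        by_contra h
        exact he.2 h heS
      subst hez
      exact Or.inl ⟨hz₁y, subset_clF_of_subset_gr (hΛ₀S.trans (hSG.trans hGg)) (by
        rw [hΛ₀def]; exact Finset.mem_insert_of_mem (Finset.mem_insert_self _ _))⟩
    · by_cases heΛ : e ∈ Λ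
      · exact Or.inl ⟨fun h => heS (h ▸ hyS), heΛ⟩
      · exact Or.inr ⟨⟨he.1, heS⟩, heΛ⟩
  have hU₁ : S.erase z₁ ∈ Uq M (4 + 2) 4 := (mem_membersIn.1 hm₁).1
  have h6 := rkN_sdiff_eq_of_mem_Uq hU₁
  have h1 : gr M \ S.erase z₁ ⊆ (G \ S.erase z₁) ∪ (gr M \ G) := by
    intro t ht
    rw [Finset.mem_sdiff] at ht
    rw [Finset.mem_union, Finset.mem_sdiff, Finset.mem_sdiff]
    by_cases htG : t ∈ G
    · exact Or.inl ⟨htG, ht.2⟩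
    · exact Or.inr ⟨ht.1, htG⟩
  have h2 := rkN_mono (M := M) h1
  have h3 := rkN_union_le_rkN_add_card (M := M) (G \ S.erase z₁) (gr M \ G)
  have h4 := rkN_mono (M := M) hsub
  have h5 := rkN_union_le_rkN_add_card (M := M) (Λ.erase y) W
  omega

open scoped Classical in
/-- Without a far preimage every pair preimage has `|G ∖ cl B| ≥ 3`. -/
theorem three_le_card_sdiff_clF_of_noFar {G S : Finset α} (hf : opFarPre M G S = ∅) {B : Finset α}
    (hB : B ∈ pairPre M 4 G S) : 3 ≤ (G \ clF M B).card := by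
  have h2 := two_le_card_sdiff_clF_of_mem_pairPre hB
  by_contra h
  have hm : (G \ clF M B).card = 2 := by omega
  have : B ∈ opFarPre M G S := mem_opFarPre_iff_mem_pairPre.2 ⟨hB, hm⟩
  rw [hf] at this
  exact Finset.notMem_empty _ this

open scoped Classical in
/-- **The pair part with two covering preimages and no far preimage**: at most `14/75`. -/
theorem sum_r14Pair_le_of_two_covPre {G : Finset α} (hG : G ∈ flatsQ M (4 + 1)) (hd : (gr M \ G).card = 2)
    (hsimple : ∀ e ∈ gr M, ∀ f ∈ gr M, e ≠ f → rkN M {e, f} = 2) {y : α} (hyG : y ∈ G)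
    (hyc : y ∉ clF M (G.erase y)) {S : Finset α} (hS : S ∈ shadowAt M (4 + 2) 4 (Uq M (4 + 2) 4) G)
    (h6 : S.card = 6) (hf : opFarPre M G S = ∅) {z₁ z₂ : α} (hz₁S : z₁ ∈ S) (hz₂S : z₂ ∈ S) (hz₁y : z₁ ≠ y)
    (hz₂y : z₂ ≠ y) (hz₁₂ : z₁ ≠ z₂) (hm₁ : S.erase z₁ ∈ membersIn M (Uq M (4 + 2) 4) G)
    (hm₂ : S.erase z₂ ∈ membersIn M (Uq M (4 + 2) 4) G) :
    ∑ B ∈ pairPre M 4 G S, r14Pair M G B ≤ 14 / 75 := by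
  obtain ⟨-, hp⟩ := card_pairPre_le_three_of_two_covPre_six hG hyG hyc hS h6 hz₁S hz₂S hz₁y hz₂y hz₁₂ hm₁ hm₂
  have hle : ∀ B ∈ pairPre M 4 G S, r14Pair M G B ≤ 2 / 25 :=
    fun B hB => r14Pair_le_of_three_le (three_le_card_sdiff_clF_of_noFar hf hB)
  rcases Nat.lt_or_ge (pairPre M 4 G S).card 3 with h2 | h3
  · calc ∑ B ∈ pairPre M 4 G S, r14Pair M G B ≤ ∑ _B ∈ pairPre M 4 G S, (2 : ℚ) / 25 := Finset.sum_le_sum hle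
      _ = ((pairPre M 4 G S).card : ℚ) * (2 / 25) := by rw [Finset.sum_const, nsmul_eq_mul]
      _ ≤ 2 * (2 / 25) := by
          have : ((pairPre M 4 G S).card : ℚ) ≤ 2 := by exact_mod_cast (by omega : (pairPre M 4 G S).card ≤ 2)
          nlinarith
      _ ≤ 14 / 75 := by norm_num
  · have h3' : (pairPre M 4 G S).card = 3 := by omega
    obtain ⟨a, b, c, hab, hac, hbc, habc⟩ := Finset.card_eq_three.1 h3'
    have ha : a ∈ pairPre M 4 G S := by rw [habc]; simp
    have hb : b ∈ pairPre M 4 G S := by rw [habc]; simp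
    have hc : c ∈ pairPre M 4 G S := by rw [habc]; simp
    rw [habc, Finset.sum_insert (by simp [hab, hac]), Finset.sum_insert (by simp [hbc]), Finset.sum_singleton]
    -- not all three have `|G ∖ cl| = 3`
    have hnot : ¬ ((G \ clF M a).card = 3 ∧ (G \ clF M b).card = 3 ∧ (G \ clF M c).card = 3) := by
      rintro ⟨h1, h2, h3⟩
      exact not_three_pairs_of_three hG hd hsimple hyG hyc hS hz₁S hz₂S hz₁y hz₂y hz₁₂ hm₁ hm₂ ha hb hc hab hac hbc
        h1 h2 h3
    have ha3 := three_le_card_sdiff_clF_of_noFar hf ha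
    have hb3 := three_le_card_sdiff_clF_of_noFar hf hb
    have hc3 := three_le_card_sdiff_clF_of_noFar hf hc
    have hla := hle a ha
    have hlb := hle b hb
    have hlc := hle c hc
    by_cases h1 : (G \ clF M a).card = 3
    · by_cases h2 : (G \ clF M b).card = 3
      · have h3 : 4 ≤ (G \ clF M c).card := by
          by_contra h
          exact hnot ⟨h1, h2, by omega⟩
        have := r14Pair_le_of_four_le h3
        linarith
      · have := r14Pair_le_of_four_le (show 4 ≤ (G \ clF M b).card by omega)
        linarith
    · have := r14Pair_le_of_four_le (show 4 ≤ (G \ clF M a).card by omega)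
      linarith

open scoped Classical in
/-- **The column of R1₄ at a six-element shadow set with two covering preimages and no far preimage is `≤ 1`**
(`≤ 2087/2100`). -/
theorem sum_r14W_col_le_of_card_six_of_two_covPre {G : Finset α} (hG : G ∈ flatsQ M (4 + 1))
    (hd : (gr M \ G).card = 2) (hsimple : ∀ e ∈ gr M, ∀ f ∈ gr M, e ≠ f → rkN M {e, f} = 2) {y : α}
    (hyG : y ∈ G) (hyc : y ∉ clF M (G.erase y)) (hP : ∀ z ∈ G.erase y, 4 ≤ rkN M ((G.erase y).erase z))
    {S : Finset α} (hS : S ∈ shadowAt M (4 + 2) 4 (Uq M (4 + 2) 4) G) (h6 : S.card = 6)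
    (hf : opFarPre M G S = ∅) {B₁ B₂ : Finset α} (h₁ : B₁ ∈ r14CovPre M G S) (h₂ : B₂ ∈ r14CovPre M G S)
    (hne : B₁ ≠ B₂) : ∑ B ∈ membersIn M (Uq M (4 + 2) 4) G, r14W M G B S ≤ 1 := by
  obtain ⟨z₁, z₂, hz₁S, hz₂S, hz₁y, hz₂y, hz₁₂, -, -, -, -, hm₁, hm₂⟩ := two_coloops_of_two_covPre hG hyG hyc h₁ h₂ hne
  have hparts := sum_r14W_col_le_parts (M := M) G S
  rw [r14KeepPre_eq_empty (by omega), Finset.sum_empty, r14PairPre_eq_pairPre] at hparts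
  have hcov : ∑ B ∈ r14CovPre M G S, r14Cov M G B ≤ 2 * (6 / 35) := by
    have h1 : ∑ B ∈ r14CovPre M G S, r14Cov M G B ≤ ((r14CovPre M G S).card : ℚ) * (6 / 35) := by
      rw [← nsmul_eq_mul, ← Finset.sum_const]
      exact Finset.sum_le_sum (fun B _ => r14Cov_le G B)
    have h2 : ((r14CovPre M G S).card : ℚ) ≤ 2 := by
      exact_mod_cast card_r14CovPre_le_two_six hG hsimple hyG hyc hS (le_of_eq h6.symm)
    nlinarith
  have hpair := sum_r14Pair_le_of_two_covPre hG hd hsimple hyG hyc hS h6 hf hz₁S hz₂S hz₁y hz₂y hz₁₂ hm₁ hm₂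
  have hspread := r14Spread_le_six hG hyG hyc hP hS h6
  have hb : (((S.erase y).filter (fun x => (S.erase y).erase x ∈ membersIn M (Uq M (4 + 2) 4) G)).card : ℚ) ≤ 3 := by
    exact_mod_cast card_basisPts_le_three_of_two_covPre hG hyG hyc hS h6 h₁ h₂ hne
  have hι := card_r14IdPre_le_one hG hyG hyc hP hS
  have hq0 : (0 : ℚ) ≤ ((G \ S).card : ℚ) := Nat.cast_nonneg _
  have hc0 : (0 : ℚ) ≤ (3 / 35) / (((G \ S).card : ℚ) + 1) := by positivity
  rcases Nat.eq_zero_or_pos (r14IdPre M G S).card with h0 | hpos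
  · rw [h0] at hparts
    have hsp : r14Spread M G S ≤ 9 / 35 := by
      have : (3 / 35 : ℚ) / (((G \ S).card : ℚ) + 1) ≤ 3 / 35 := by
        rw [div_le_iff₀ (by positivity)]
        nlinarith
      nlinarith
    simp only [Nat.cast_zero, zero_mul, zero_add] at hparts
    linarith
  · obtain ⟨B, hB⟩ := Finset.card_pos.1 hpos
    have hq := three_le_card_sdiff_of_idPre hG hd hyG hyc hP hS hB
    have hsp : r14Spread M G S ≤ 9 / 140 := by
      have hq' : (3 : ℚ) ≤ ((G \ S).card : ℚ) := by exact_mod_cast hq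
      have : (3 / 35 : ℚ) / (((G \ S).card : ℚ) + 1) ≤ 3 / 140 := by
        rw [div_le_iff₀ (by positivity)]
        nlinarith
      nlinarith
    have hι' : ((r14IdPre M G S).card : ℚ) ≤ 1 := by exact_mod_cast hι
    nlinarith

end PercRepro.Shadow
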